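import Summits.FinalStateConjecture.FinalStateConjecture.Theses.ZeroEnergyKerrOrBomb
import Summits.FinalStateConjecture.FinalStateConjecture.Theorems.ZeroEnergyKerrOrBombKerrOrBombOfCruxes

/-!
# Route ZeroEnergyKerrOrBomb — the assembly `Assembly`

Assembly item `stmt-FinalStateConjecture-10025` of route `ZeroEnergyKerrOrBomb` for the Final State
Conjecture: the propositional assembly

`ZeroEnergyRigidity → ErgoregionBomb → StationaryLimitReduction → FinalStateConjecture`.

`StationaryLimitReduction` is by definition `KerrOrBomb → FinalStateConjecture`, and the landed glue
`KerrOrBombOfCruxes_proof : ZeroEnergyRigidity → ErgoregionBomb → KerrOrBomb`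
(file `ZeroEnergyKerrOrBombKerrOrBombOfCruxes.lean`, item `stmt-FinalStateConjecture-10022`) supplies
its hypothesis. Classical logic only; no analysis happens here.
-/

-- every `Summit.FinalStateConjecture.FinalStateConjecture.…` name repeats the summit = sub-problem
-- segment (D-0017 layout, CONVENTIONS §2; lakefile sets it for the library build, a standalone
-- elaboration of this file does not see that option); the duplicate is deliberate.
set_option linter.dupNamespace false

namespace Summit.FinalStateConjecture.FinalStateConjecture.Theorems

open Summit.FinalStateConjecture.FinalStateConjecture.Theses.ZeroEnergyKerrOrBomb in
/-- **Assembly of route ZeroEnergyKerrOrBomb** (item `stmt-FinalStateConjecture-10025`):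
`ZeroEnergyRigidity → ErgoregionBomb → StationaryLimitReduction → FinalStateConjecture`.
The two stationary cruxes give the target `KerrOrBomb` through the glue
`KerrOrBombOfCruxes_proof`, and `StationaryLimitReduction : KerrOrBomb → FinalStateConjecture`
turns it into the summit statement. -/
theorem ZeroEnergyKerrOrBombAssembly_proof :
    Summit.FinalStateConjecture.FinalStateConjecture.Theses.ZeroEnergyKerrOrBomb.Assembly := by
  unfold Assembly
  intro hZ hE hS
  exact hS (KerrOrBombOfCruxes_proof hZ hE)

end Summit.FinalStateConjecture.FinalStateConjecture.Theorems
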